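import Summits.Schanuel.Schanuel.Theses.RoyCriterion
import Literature.Barriers.Schanuel.AlgebraicIndependenceOfLogarithms
import Literature.Barriers.Schanuel.LargeTranscendenceDegree

/-!
# Crux triage r1 / triager 2 (gen 2) — evidence for card `torsion-companion-period-sector`

Card 3 leans on ONE unproved-in-tree input, typed in `SketchIdeator3.lean` as
`Sketch.Chudnovsky1984_thm_7_4_1_i` (Chudnovsky 1984, *Contributions*, Ch. 7 Thm 4.1 (i), p.318,
stated with HALF-periods `ωᵢ`, hence the `L.ωᵢ / 2` in the typed form).  The printed, refereed
proof of that statement is Tubbs, *Algebraic groups and small transcendence degree II*,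
J. Number Theory 35 (1990) 109–127, Theorem 4 + the remark on p.114 ("it more generally follows
from Theorem 4 that if ℘ is a Weierstrass ℘-function, then for any λ ≠ 0 at least two of
g₂, g₃, ω₁, ω₂, λ, e^{λω₁}, e^{λω₂} are algebraically independent"; Remark (1): "Theorem 4
generalizes … [3, Theorem 4.1(i)]"), where `Ω = ℤω₁ + ℤω₂` is the lattice of PERIODS (p.112).

This file checks, kernel-side, the two cheap things a triager must check about that input:
* (convention) the PERIODS form (Tubbs) implies the HALF-period form typed in the sketch
  (`chudnovsky_halfPeriod_of_tubbs`), so vendoring Tubbs's statement verbatim serves the card;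
* (reach) the periods form gives Schanuel's conjecture in rank 2 on the card's period sector
  (`schanuelTwo_of_periodSector`), i.e. the card's first lemma, in a dozen lines from the tree's
  `trdeg_adjoin_union_eq_of_isAlgebraic` / `trdeg_mono`; and the sector lies inside the crux's
  quantifier domain (`InPeriodSector y → LinearIndependent ℚ y`), so it is not vacuous there.
Nothing here concludes the crux decl `RoyCriterion.RoyThesisTyped` (the card claims no Transfer).
-/

noncomputable section

open Complex

namespace TriageR1K2G2

/-- NAMED-FACT CANDIDATE (periods convention) — Tubbs 1990, JNT 35, Thm 4 + p.114 remark
(⊇ Chudnovsky 1984 Ch.7 Thm 4.1 (i)): for every lattice `ℤω₁ + ℤω₂` with invariants `g₂, g₃`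
and every `φ ≠ 0`, `trdeg_ℚ ℚ(g₂, g₃, ω₁, ω₂, φ, e^{φω₁}, e^{φω₂}) ≥ 2`.
[cite doi:10.1016/0022-314x(90)90107-3 p.114] -/
def Tubbs1990_thm4_periods : Prop :=
  ∀ (L : PeriodPair) (φ : ℂ), φ ≠ 0 →
    (2 : Cardinal) ≤ Algebra.trdeg ℚ ↥(IntermediateField.adjoin ℚ
      ({L.g₂, L.g₃, L.ω₁, L.ω₂, φ, cexp (φ * L.ω₁), cexp (φ * L.ω₂)} : Set ℂ))

/-- Verbatim `Sketch.Chudnovsky1984_thm_7_4_1_i` (SketchIdeator3.lean, half-period convention). -/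
def Chudnovsky1984_thm_7_4_1_i : Prop :=
  ∀ (L : PeriodPair) (φ : ℂ), φ ≠ 0 →
    (2 : Cardinal) ≤ Algebra.trdeg ℚ ↥(IntermediateField.adjoin ℚ
      ({L.g₂, L.g₃, L.ω₁ / 2, L.ω₂ / 2, φ, cexp (φ * (L.ω₁ / 2)), cexp (φ * (L.ω₂ / 2))} : Set ℂ))

/-- Verbatim `Sketch.InPeriodSector` (SketchIdeator3.lean). -/
def InPeriodSector (y : Fin 2 → ℂ) : Prop :=
  ∃ L : PeriodPair, L.ω₁ = y 0 ∧ L.ω₂ = y 1 ∧ IsAlgebraic ℚ L.g₂ ∧ IsAlgebraic ℚ L.g₃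

/-- Convention check: the periods form implies the half-period form (apply it at `φ/2`; the
generated fields coincide, one inclusion suffices). [folklore] -/
theorem chudnovsky_halfPeriod_of_tubbs (hT : Tubbs1990_thm4_periods) :
    Chudnovsky1984_thm_7_4_1_i := by
  intro L φ hφ
  have h := hT L (φ / 2) (div_ne_zero hφ two_ne_zero)
  set T₁ : Set ℂ :=
    {L.g₂, L.g₃, L.ω₁ / 2, L.ω₂ / 2, φ, cexp (φ * (L.ω₁ / 2)), cexp (φ * (L.ω₂ / 2))} with hT₁
  have hsub : T₁ ⊆ (IntermediateField.adjoin ℚ T₁ : Set ℂ) := IntermediateField.subset_adjoin ℚ T₁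
  have h2 : (2 : ℂ) ∈ IntermediateField.adjoin ℚ T₁ := by
    exact_mod_cast natCast_mem (IntermediateField.adjoin ℚ T₁) 2
  have hle : IntermediateField.adjoin ℚ
      ({L.g₂, L.g₃, L.ω₁, L.ω₂, φ / 2, cexp (φ / 2 * L.ω₁), cexp (φ / 2 * L.ω₂)} : Set ℂ) ≤
      IntermediateField.adjoin ℚ T₁ := by
    refine IntermediateField.adjoin_le_iff.mpr ?_
    intro x hx
    simp only [Set.mem_insert_iff, Set.mem_singleton_iff] at hx
    rcases hx with rfl | rfl | rfl | rfl | rfl | rfl | rfl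
    · exact hsub (by simp [hT₁])
    · exact hsub (by simp [hT₁])
    · have e : L.ω₁ = 2 * (L.ω₁ / 2) := by ring
      rw [e]; exact mul_mem h2 (hsub (by simp [hT₁]))
    · have e : L.ω₂ = 2 * (L.ω₂ / 2) := by ring
      rw [e]; exact mul_mem h2 (hsub (by simp [hT₁]))
    · exact div_mem (hsub (by simp [hT₁])) h2
    · have e : φ / 2 * L.ω₁ = φ * (L.ω₁ / 2) := by ring
      rw [e]; exact hsub (by simp [hT₁])
    · have e : φ / 2 * L.ω₂ = φ * (L.ω₂ / 2) := by ring
      rw [e]; exact hsub (by simp [hT₁])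
  exact h.trans (Literature.Barriers.Schanuel.trdeg_mono hle)

/-- The period sector lies inside the crux's quantifier domain: a lattice basis is `ℚ`-linearly
independent (it is even `ℝ`-linearly independent). [folklore] -/
theorem linearIndependent_of_inPeriodSector {y : Fin 2 → ℂ} (hy : InPeriodSector y) :
    LinearIndependent ℚ y := by
  obtain ⟨L, h1, h2, -, -⟩ := hy
  have e : y = ![L.ω₁, L.ω₂] := by
    ext i; fin_cases i <;> simp [h1, h2]
  rw [e]
  exact L.indep.restrict_scalars' ℚ

/-- Card 3's first lemma from the periods form: Schanuel's conjecture in rank 2 on the period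
sector (`φ = 1`; adjoining the algebraic `g₂, g₃, 1` does not change `trdeg`). [folklore] -/
theorem schanuelTwo_of_periodSector (hT : Tubbs1990_thm4_periods) (y : Fin 2 → ℂ)
    (hy : InPeriodSector y) :
    (2 : Cardinal) ≤ Algebra.trdeg ℚ
      ↥(IntermediateField.adjoin ℚ (Set.range y ∪ Set.range (cexp ∘ y))) := by
  obtain ⟨L, h1, h2, hg2, hg3⟩ := hy
  -- NB: `trdeg` carries the `ℚ`-algebra instance of the generated subfield, so we do not rewrite
  -- `1 * ω` inside it; the set inclusion below absorbs the `1 * ·`.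
  have h := hT L 1 one_ne_zero
  set S : Set ℂ := Set.range y ∪ Set.range (cexp ∘ y) with hS
  set A : Set ℂ := {L.g₂, L.g₃, 1} with hAdef
  have hA : ∀ x ∈ A, IsAlgebraic ℚ x := by
    intro x hx
    simp only [hAdef, Set.mem_insert_iff, Set.mem_singleton_iff] at hx
    rcases hx with rfl | rfl | rfl
    · exact hg2
    · exact hg3
    · exact isAlgebraic_one
  have hsub :
      ({L.g₂, L.g₃, L.ω₁, L.ω₂, (1 : ℂ), cexp (1 * L.ω₁), cexp (1 * L.ω₂)} : Set ℂ) ⊆ S ∪ A := by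
    intro x hx
    simp only [Set.mem_insert_iff, Set.mem_singleton_iff] at hx
    rcases hx with rfl | rfl | rfl | rfl | rfl | rfl | rfl
    · exact Or.inr (by simp [hAdef])
    · exact Or.inr (by simp [hAdef])
    · exact Or.inl (Or.inl ⟨0, h1.symm⟩)
    · exact Or.inl (Or.inl ⟨1, h2.symm⟩)
    · exact Or.inr (by simp [hAdef])
    · exact Or.inl (Or.inr ⟨0, by simp [h1]⟩)
    · exact Or.inl (Or.inr ⟨1, by simp [h2]⟩)
  calc (2 : Cardinal) ≤ _ := h
    _ ≤ Algebra.trdeg ℚ ↥(IntermediateField.adjoin ℚ (S ∪ A)) :=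
        Literature.Barriers.Schanuel.trdeg_mono (IntermediateField.adjoin.mono ℚ _ _ hsub)
    _ = Algebra.trdeg ℚ ↥(IntermediateField.adjoin ℚ S) :=
        Literature.Barriers.Schanuel.trdeg_adjoin_union_eq_of_isAlgebraic S A hA

end TriageR1K2G2

end
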